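import Literature.MathematicalPhysics.StatisticalMechanics.BarlowStacking

/-!
# Crux `PeriodicWindows` (stmt-AtomisticToContinuum-3240), line `Sketch` — stub E0b3:
# levels ⇒ rotated Barlow stacking (bookkeeping)

Stub `stub_barlowOfLevels` of the line skeleton.  A point set `X ⊆ ℝ³` containing `0` whose
level `{q ∈ X | q 2 = 0}` is a horizontal triangular lattice `ℤu + ℤv` (`‖u‖ = ‖v‖ = a`,
`⟪u, v⟫ = a²/2`, `u 2 = v 2 = 0`) and whose levels propagate by the STEP property (a level
`p + ℤu + ℤv` forces the levels at heights `p 2 ± h` to be `p ± h e₃ ± (u + v)/3 + ℤu + ℤv` and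
forbids heights strictly within `h` of `p 2` other than `p 2`) is `A '' barlowStacking a h s`
for a Hägg sequence `s` and a linear isometry `A` of `ℝ³`:

* `levels_exists_haggSeq` — two `ℕ`-recursions (upwards, downwards) on the levels, the
  integrated sign sequence being `haggLabel s` (pattern of
  `CLayerWitnessLayering.layeringLayers_exists_barlowStacking_subset`);
* `exists_linearIsometry_frame`, `exists_linearIsometry_barlowPos` — the orthonormal frame
  `(u/a, (2v − u)/(a√3), e₃)` gives a linear isometry `A` with
  `A (barlowPos a h s k i j) = (haggLabel s k) (u + v)/3 + k h e₃ + i u + j v`;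
* `stub_barlowOfLevels` — every height of `X` is an integer multiple of `h` (floor + the gap
  clause), so `X` is the union of the levels, i.e. `A '' barlowStacking a h s`.

All `[folklore]` (Hales, *Dense Sphere Packings* §1.3; Conway–Sloane Ch. 1 §1.3).
-/

noncomputable section

namespace Summit.AtomisticToContinuum.Crystallization.Theorems.PeriodicWindowsSketch

open Literature.MathematicalPhysics.StatisticalMechanics

/-! ## The levels: two `ℕ`-recursions -/

/-- **All the levels.** If the level of `0` is `ℤu + ℤv` and every level `p + ℤu + ℤv` (`p ∈ X`)
forces the levels at heights `p 2 ± h` to be `p ± h e + (sign) w + ℤu + ℤv` (`w 2 = 0`, `e 2 = 1`)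
and no height of `X` strictly within `h` of `p 2` other than `p 2`, then for a Hägg sequence `s`
the level of `X` at height `k h` is `(haggLabel s k) w + k h e + ℤu + ℤv` and no height of `X` is
strictly within `h` of `k h` other than `k h`, for every `k : ℤ` (upward and downward recursion on
the levels; the recursion of `layeringLayers_exists_barlowStacking_subset`). [folklore] -/
theorem levels_exists_haggSeq {X : Set (EuclideanSpace ℝ (Fin 3))} {h : ℝ}
    {u v w e : EuclideanSpace ℝ (Fin 3)} (hw2 : w 2 = 0) (he2 : e 2 = 1)
    (hlev0 : {q ∈ X | q 2 = 0} = {q | ∃ i j : ℤ, q = (i : ℝ) • u + (j : ℝ) • v})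
    (hstep : ∀ p ∈ X, {q ∈ X | q 2 = p 2} = {q | ∃ i j : ℤ, q = p + (i : ℝ) • u + (j : ℝ) • v} →
      ∃ σ τ : ℝ, (σ = 1 ∨ σ = -1) ∧ (τ = 1 ∨ τ = -1) ∧
        {q ∈ X | q 2 = p 2 + h} =
          {q | ∃ i j : ℤ, q = p + h • e + σ • w + (i : ℝ) • u + (j : ℝ) • v} ∧
        {q ∈ X | q 2 = p 2 - h} =
          {q | ∃ i j : ℤ, q = p - h • e + τ • w + (i : ℝ) • u + (j : ℝ) • v} ∧
        ∀ q ∈ X, |q 2 - p 2| < h → q 2 = p 2) :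
    ∃ s : ℤ → ℤ, IsHaggSeq s ∧ ∀ k : ℤ,
      (∀ q, (q ∈ X ∧ q 2 = k * h) ↔ ∃ i j : ℤ,
        q = (haggLabel s k : ℝ) • w + (k : ℝ) • (h • e) + (i : ℝ) • u + (j : ℝ) • v) ∧
      ∀ q ∈ X, |q 2 - k * h| < h → q 2 = k * h := by
  classical
  -- the level predicate: the level of `X` at height `c 2` is `c + ℤu + ℤv`
  let Lev : EuclideanSpace ℝ (Fin 3) → Prop := fun c =>
    {q ∈ X | q 2 = c 2} = {q | ∃ i j : ℤ, q = c + (i : ℝ) • u + (j : ℝ) • v}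
  have hmem : ∀ c, Lev c → c ∈ X := fun c hc => by
    have hc' : {q ∈ X | q 2 = c 2} = {q | ∃ i j : ℤ, q = c + (i : ℝ) • u + (j : ℝ) • v} := hc
    have h1 : c ∈ {q ∈ X | q 2 = c 2} := by rw [hc']; exact ⟨0, 0, by simp⟩
    exact h1.1
  have hLev0 : Lev 0 := by
    show {q ∈ X | q 2 = (0 : EuclideanSpace ℝ (Fin 3)) 2} =
      {q | ∃ i j : ℤ, q = 0 + (i : ℝ) • u + (j : ℝ) • v}
    simpa only [PiLp.zero_apply, zero_add] using hlev0
  -- one level forces the next, upwards (`t = 1`) and downwards (`t = -1`)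
  have hnext : ∀ (c : EuclideanSpace ℝ (Fin 3)) (t : ℝ), Lev c → (t = 1 ∨ t = -1) →
      ∃ σ : ℝ, (σ = 1 ∨ σ = -1) ∧ Lev (c + σ • w + t • (h • e)) := by
    intro c t hc ht
    obtain ⟨σ, τ, hσ, hτ, hup, hdn, -⟩ := hstep c (hmem c hc) hc
    rcases ht with rfl | rfl
    · refine ⟨σ, hσ, ?_⟩
      have e1 : c + σ • w + (1 : ℝ) • (h • e) = c + h • e + σ • w := by rw [one_smul]; abel
      have e2 : (c + h • e + σ • w) 2 = c 2 + h := by simp [hw2, he2]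
      show {q ∈ X | q 2 = (c + σ • w + (1 : ℝ) • (h • e)) 2} =
        {q | ∃ i j : ℤ, q = c + σ • w + (1 : ℝ) • (h • e) + (i : ℝ) • u + (j : ℝ) • v}
      rw [e1, e2, hup]
    · refine ⟨τ, hτ, ?_⟩
      have e1 : c + τ • w + (-1 : ℝ) • (h • e) = c - h • e + τ • w := by
        rw [neg_one_smul]; abel
      have e2 : (c - h • e + τ • w) 2 = c 2 - h := by simp [hw2, he2]
      show {q ∈ X | q 2 = (c + τ • w + (-1 : ℝ) • (h • e)) 2} =
        {q | ∃ i j : ℤ, q = c + τ • w + (-1 : ℝ) • (h • e) + (i : ℝ) • u + (j : ℝ) • v}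
      rw [e1, e2, hdn]
  -- the next sign, as a function of the level base point
  let next : EuclideanSpace ℝ (Fin 3) → ℝ → ℤ := fun c t =>
    if Lev (c + w + t • (h • e)) then 1 else -1
  have next_spec : ∀ (c : EuclideanSpace ℝ (Fin 3)) (t : ℝ), Lev c → (t = 1 ∨ t = -1) →
      (next c t = 1 ∨ next c t = -1) ∧ Lev (c + (next c t : ℝ) • w + t • (h • e)) := by
    intro c t hc ht
    obtain ⟨σ, hσ, hlay⟩ := hnext c t hc ht
    by_cases hL : Lev (c + w + t • (h • e))
    · have hn : next c t = 1 := if_pos hL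
      refine ⟨Or.inl hn, ?_⟩
      rw [hn]; simpa using hL
    · have hn : next c t = -1 := if_neg hL
      refine ⟨Or.inr hn, ?_⟩
      rcases hσ with rfl | rfl
      · exact absurd (by simpa using hlay) hL
      · rw [hn]; simpa using hlay
  -- the bases of the levels, upwards (`t = 1`) and downwards (`t = -1`)
  let base : ℝ → ℕ → EuclideanSpace ℝ (Fin 3) := fun t n =>
    Nat.rec (motive := fun _ => EuclideanSpace ℝ (Fin 3)) 0
      (fun _ b => b + (next b t : ℝ) • w + t • (h • e)) n
  have base_zero : ∀ t, base t 0 = 0 := fun t => rfl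
  have base_succ : ∀ t n, base t (n + 1) = base t n + (next (base t n) t : ℝ) • w + t • (h • e) :=
    fun t n => rfl
  have base_spec : ∀ t, (t = 1 ∨ t = -1) → ∀ n, Lev (base t n) ∧
      (next (base t n) t = 1 ∨ next (base t n) t = -1) := by
    intro t ht n
    induction n with
    | zero => exact ⟨hLev0, (next_spec 0 t hLev0 ht).1⟩
    | succ n ih =>
      have h1 := (next_spec _ t ih.1 ht).2
      rw [← base_succ] at h1
      exact ⟨h1, (next_spec _ t h1 ht).1⟩
  -- the Hägg sequence
  let sq : ℤ → ℤ := fun k =>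
    if 0 ≤ k then next (base 1 k.toNat) 1 else -next (base (-1) (-k - 1).toNat) (-1)
  have hsq : IsHaggSeq sq := by
    intro k
    by_cases hk : 0 ≤ k
    · simp only [sq, if_pos hk]
      exact (base_spec 1 (Or.inl rfl) _).2
    · simp only [sq, if_neg hk]
      rcases (base_spec (-1) (Or.inr rfl) (-k - 1).toNat).2 with h' | h' <;> rw [h'] <;> norm_num
  have sq_nat : ∀ n : ℕ, sq n = next (base 1 n) 1 := fun n => by
    simp only [sq, if_pos (Int.natCast_nonneg n), Int.toNat_natCast]
  have sq_neg : ∀ n : ℕ, sq (-((n : ℤ) + 1)) = -next (base (-1) n) (-1) := fun n => by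
    have h1 : ¬ (0 : ℤ) ≤ -((n : ℤ) + 1) := by omega
    have h2 : (-(-((n : ℤ) + 1)) - 1).toNat = n := by simp
    simp only [sq, if_neg h1, h2]
  -- the level bases are those of the Barlow stacking of `sq`
  have up : ∀ n : ℕ, base 1 n = (haggLabel sq n : ℝ) • w + ((n : ℤ) : ℝ) • (h • e) := by
    intro n
    induction n with
    | zero => simp [base_zero]
    | succ n ih =>
      rw [base_succ]
      set ν := next (base 1 n) 1 with hν
      rw [ih, Nat.cast_succ, haggLabel_succ, sq_nat n, ← hν]
      push_cast
      module
  have down : ∀ n : ℕ, base (-1) n =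
      (haggLabel sq (-(n : ℤ)) : ℝ) • w + ((-(n : ℤ) : ℤ) : ℝ) • (h • e) := by
    intro n
    induction n with
    | zero => simp [base_zero]
    | succ n ih =>
      have hrec : haggLabel sq (-(n : ℤ)) =
          haggLabel sq (-((n : ℤ) + 1)) + sq (-((n : ℤ) + 1)) := by
        have := haggLabel_succ sq (-((n : ℤ) + 1))
        rwa [show -((n : ℤ) + 1) + 1 = -(n : ℤ) by ring] at this
      rw [base_succ]
      set ν := next (base (-1) n) (-1) with hν
      rw [ih]
      have e3 : (haggLabel sq (-((n + 1 : ℕ) : ℤ)) : ℝ) = haggLabel sq (-(n : ℤ)) + ν := by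
        rw [Nat.cast_succ, hrec, sq_neg n, ← hν]; push_cast; ring
      rw [e3]
      push_cast
      module
  -- all the levels
  have hLevAll : ∀ k : ℤ, Lev ((haggLabel sq k : ℝ) • w + (k : ℝ) • (h • e)) := by
    intro k
    rcases le_or_gt 0 k with hk | hk
    · lift k to ℕ using hk
      have h1 := (base_spec 1 (Or.inl rfl) k).1
      rwa [up k] at h1
    · obtain ⟨n, rfl⟩ : ∃ n : ℕ, k = -(n : ℤ) := ⟨(-k).toNat, by omega⟩
      have h1 := (base_spec (-1) (Or.inr rfl) n).1
      rwa [down n] at h1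
  have happ : ∀ k : ℤ, ((haggLabel sq k : ℝ) • w + (k : ℝ) • (h • e)) 2 = k * h := fun k => by
    simp [hw2, he2]
  refine ⟨sq, hsq, fun k => ⟨fun q => ?_, fun q hq hqk => ?_⟩⟩
  · have h1 := Set.ext_iff.1 (hLevAll k) q
    simpa only [Set.mem_setOf_eq, happ] using h1
  · have hL := hLevAll k
    obtain ⟨-, -, -, -, -, -, hgap⟩ := hstep _ (hmem _ hL) hL
    rw [happ] at hgap
    exact hgap q hq hqk

/-! ## The frame isometry -/

/-- **The orthonormal frame.** For horizontal `u, v` (`u 2 = v 2 = 0`) with `‖u‖ = ‖v‖ = a > 0` and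
`⟪u, v⟫ = a²/2`, the triple `(u/a, (2v − u)/(a√3), e₃)` is orthonormal, so there is a linear
isometry `A` of `ℝ³` with `A x = x₀ u/a + x₁ (2v − u)/(a√3) + x₂ e₃`. [folklore] -/
theorem exists_linearIsometry_frame {a : ℝ} (ha : 0 < a) {u v : EuclideanSpace ℝ (Fin 3)}
    (hu2 : u 2 = 0) (hv2 : v 2 = 0) (hu : ‖u‖ = a) (hv : ‖v‖ = a)
    (huv : inner ℝ u v = a ^ 2 / 2) :
    ∃ A : EuclideanSpace ℝ (Fin 3) →ₗᵢ[ℝ] EuclideanSpace ℝ (Fin 3),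
      ∀ x : EuclideanSpace ℝ (Fin 3), A x = x 0 • (a⁻¹ • u) +
        x 1 • ((a * Real.sqrt 3)⁻¹ • ((2 : ℝ) • v - u)) +
        x 2 • EuclideanSpace.single (2 : Fin 3) (1 : ℝ) := by
  classical
  set f0 : EuclideanSpace ℝ (Fin 3) := a⁻¹ • u with hf0
  set f1 : EuclideanSpace ℝ (Fin 3) := (a * Real.sqrt 3)⁻¹ • ((2 : ℝ) • v - u) with hf1
  set f2 : EuclideanSpace ℝ (Fin 3) := EuclideanSpace.single (2 : Fin 3) (1 : ℝ) with hf2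
  have h3 : Real.sqrt 3 * Real.sqrt 3 = 3 := Real.mul_self_sqrt (by norm_num)
  have hs3 : 0 < Real.sqrt 3 := Real.sqrt_pos.2 (by norm_num)
  have huu : inner ℝ u u = a ^ 2 := by rw [real_inner_self_eq_norm_sq, hu]
  have hvv : inner ℝ v v = a ^ 2 := by rw [real_inner_self_eq_norm_sq, hv]
  have hvu : inner ℝ v u = a ^ 2 / 2 := by rw [real_inner_comm, huv]
  have hue : inner ℝ u f2 = 0 := by rw [hf2, EuclideanSpace.inner_single_right]; simp [hu2]
  have hve : inner ℝ v f2 = 0 := by rw [hf2, EuclideanSpace.inner_single_right]; simp [hv2]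
  -- the inner-product table of the frame
  have h00 : inner ℝ f0 f0 = 1 := by
    rw [hf0, real_inner_smul_left, real_inner_smul_right, huu, ← mul_assoc, ← mul_inv, ← sq,
      inv_mul_cancel₀ (pow_ne_zero 2 ha.ne')]
  have h2vu : inner ℝ ((2 : ℝ) • v - u) ((2 : ℝ) • v - u) = 3 * a ^ 2 := by
    simp only [inner_sub_left, inner_sub_right, real_inner_smul_left, real_inner_smul_right, huu,
      hvv, huv, hvu]
    ring
  have h11 : inner ℝ f1 f1 = 1 := by
    have hprod : a * Real.sqrt 3 * (a * Real.sqrt 3) = 3 * a ^ 2 := by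
      rw [mul_mul_mul_comm, h3]; ring
    rw [hf1, real_inner_smul_left, real_inner_smul_right, h2vu, ← mul_assoc, ← mul_inv, hprod,
      inv_mul_cancel₀ (by positivity)]
  have h22 : inner ℝ f2 f2 = 1 := by rw [hf2, EuclideanSpace.inner_single_right]; simp
  have h01 : inner ℝ f0 f1 = 0 := by
    have h' : inner ℝ u ((2 : ℝ) • v - u) = 0 := by
      rw [inner_sub_right, real_inner_smul_right, huv, huu]; ring
    rw [hf0, hf1, real_inner_smul_left, real_inner_smul_right, h', mul_zero, mul_zero]
  have h10 : inner ℝ f1 f0 = 0 := by rw [real_inner_comm, h01]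
  have h02 : inner ℝ f0 f2 = 0 := by rw [hf0, real_inner_smul_left, hue, mul_zero]
  have h20 : inner ℝ f2 f0 = 0 := by rw [real_inner_comm, h02]
  have h12 : inner ℝ f1 f2 = 0 := by
    rw [hf1, real_inner_smul_left, inner_sub_left, real_inner_smul_left, hue, hve]; ring
  have h21 : inner ℝ f2 f1 = 0 := by rw [real_inner_comm, h12]
  have hnorm : ∀ x : EuclideanSpace ℝ (Fin 3), inner ℝ x x = 1 → ‖x‖ = 1 := fun x hx => by
    rw [real_inner_self_eq_norm_sq] at hx
    exact (sq_eq_sq₀ (norm_nonneg x) zero_le_one).1 (by rw [hx, one_pow])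
  have hon : Orthonormal ℝ ![f0, f1, f2] := by
    rw [orthonormal_iff_ite]
    intro i j
    fin_cases i <;> fin_cases j <;>
      simp [hnorm f0 h00, h01, h02, h10, hnorm f1 h11, h12, h20, h21, hnorm f2 h22]
  let b : OrthonormalBasis (Fin 3) ℝ (EuclideanSpace ℝ (Fin 3)) := OrthonormalBasis.mk hon
    (by rw [hon.linearIndependent.span_eq_top_of_card_eq_finrank (by simp)])
  have hb : ∀ k, b k = ![f0, f1, f2] k := fun k => by rw [OrthonormalBasis.coe_mk]
  refine ⟨b.repr.symm.toLinearIsometry, fun x => ?_⟩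
  rw [LinearIsometryEquiv.coe_toLinearIsometry, ← b.sum_repr_symm x, Fin.sum_univ_three, hb, hb, hb]
  simp

/-- **The frame isometry on the Barlow stacking.** With `A` the frame isometry of
`exists_linearIsometry_frame`: `A (barlowPos a h s k i j) = (haggLabel s k) (u + v)/3 + k (h e₃) +
i u + j v` for every Hägg code `s` and all `k, i, j : ℤ` (coordinates `barlowPos_apply_*`).
[folklore] -/
theorem exists_linearIsometry_barlowPos {a : ℝ} (ha : 0 < a) (h : ℝ)
    {u v : EuclideanSpace ℝ (Fin 3)} (hu2 : u 2 = 0) (hv2 : v 2 = 0) (hu : ‖u‖ = a) (hv : ‖v‖ = a)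
    (huv : inner ℝ u v = a ^ 2 / 2) :
    ∃ A : EuclideanSpace ℝ (Fin 3) →ₗᵢ[ℝ] EuclideanSpace ℝ (Fin 3), ∀ (s : ℤ → ℤ) (k i j : ℤ),
      A (barlowPos a h s k i j) = (haggLabel s k : ℝ) • ((1 / 3 : ℝ) • (u + v)) +
        (k : ℝ) • (h • EuclideanSpace.single (2 : Fin 3) (1 : ℝ)) + (i : ℝ) • u + (j : ℝ) • v := by
  obtain ⟨A, hA⟩ := exists_linearIsometry_frame ha hu2 hv2 hu hv huv
  refine ⟨A, fun s k i j => ?_⟩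
  rw [hA, barlowPos_apply_zero, barlowPos_apply_one, barlowPos_apply_two]
  have ha' : a ≠ 0 := ha.ne'
  have hs3 : Real.sqrt 3 ≠ 0 := (Real.sqrt_pos.2 (by norm_num : (0 : ℝ) < 3)).ne'
  match_scalars <;> field_simp <;> ring

/-! ## The stub -/

/-- **E0b3 (bookkeeping: levels ⇒ rotated Barlow stacking).** A point set `X ∋ 0` of `ℝ³` whose
level `{q ∈ X | q 2 = 0}` is the horizontal triangular lattice `ℤu + ℤv` (`‖u‖ = ‖v‖ = a`,
`⟪u, v⟫ = a²/2`) and whose levels have the STEP property (a level `p + ℤu + ℤv` forces the levels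
at heights `p 2 ± h` to be `p ± h e₃ ± (u + v)/3 + ℤu + ℤv`, and no height of `X` lies strictly
within `h` of `p 2` except `p 2`) is `A '' barlowStacking a h s` for a Hägg sequence `s` and a
linear isometry `A` (`levels_exists_haggSeq` for the levels, `⌊q 2 / h⌋` and the gap clause for
the heights, `exists_linearIsometry_barlowPos` for the frame). [folklore] -/
theorem stub_barlowOfLevels (X : Set (EuclideanSpace ℝ (Fin 3))) (a h : ℝ) (ha : 0 < a) (hh : 0 < h)
    (_h0 : (0 : EuclideanSpace ℝ (Fin 3)) ∈ X) (u v : EuclideanSpace ℝ (Fin 3)) (hu2 : u 2 = 0)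
    (hv2 : v 2 = 0) (hu : ‖u‖ = a) (hv : ‖v‖ = a) (huv : inner ℝ u v = a ^ 2 / 2)
    (hlev0 : {q ∈ X | q 2 = 0} = {q | ∃ i j : ℤ, q = (i : ℝ) • u + (j : ℝ) • v})
    (hstep : ∀ p ∈ X, {q ∈ X | q 2 = p 2} = {q | ∃ i j : ℤ, q = p + (i : ℝ) • u + (j : ℝ) • v} →
      ∃ σ τ : ℝ, (σ = 1 ∨ σ = -1) ∧ (τ = 1 ∨ τ = -1) ∧
        {q ∈ X | q 2 = p 2 + h} =
          {q | ∃ i j : ℤ, q = p + h • EuclideanSpace.single (2 : Fin 3) (1 : ℝ) +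
            σ • ((1 / 3 : ℝ) • (u + v)) + (i : ℝ) • u + (j : ℝ) • v} ∧
        {q ∈ X | q 2 = p 2 - h} =
          {q | ∃ i j : ℤ, q = p - h • EuclideanSpace.single (2 : Fin 3) (1 : ℝ) +
            τ • ((1 / 3 : ℝ) • (u + v)) + (i : ℝ) • u + (j : ℝ) • v} ∧
        ∀ q ∈ X, |q 2 - p 2| < h → q 2 = p 2) :
    ∃ (s : ℤ → ℤ) (A : EuclideanSpace ℝ (Fin 3) →ₗᵢ[ℝ] EuclideanSpace ℝ (Fin 3)),
      IsHaggSeq s ∧ X = A '' barlowStacking a h s := by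
  have he2 : (EuclideanSpace.single (2 : Fin 3) (1 : ℝ) : EuclideanSpace ℝ (Fin 3)) 2 = 1 := by
    simp
  have hw2 : ((1 / 3 : ℝ) • (u + v)) 2 = 0 := by simp [hu2, hv2]
  obtain ⟨s, hs, hlev⟩ := levels_exists_haggSeq (X := X) (u := u) (v := v)
    (w := (1 / 3 : ℝ) • (u + v)) (e := EuclideanSpace.single (2 : Fin 3) (1 : ℝ)) hw2 he2 hlev0 hstep
  obtain ⟨A, hA⟩ := exists_linearIsometry_barlowPos ha h hu2 hv2 hu hv huv
  refine ⟨s, A, hs, Set.ext fun q => ⟨fun hq => ?_, ?_⟩⟩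
  · -- the height of `q` is an integer multiple of `h`
    have h1 : ((⌊q 2 / h⌋ : ℤ) : ℝ) ≤ q 2 / h := Int.floor_le _
    have h2 : q 2 / h < (⌊q 2 / h⌋ : ℤ) + 1 := Int.lt_floor_add_one _
    rw [le_div_iff₀ hh] at h1
    rw [div_lt_iff₀ hh] at h2
    have hqk : |q 2 - (⌊q 2 / h⌋ : ℤ) * h| < h := by
      rw [abs_lt]; constructor <;> linarith
    have hq2 : q 2 = (⌊q 2 / h⌋ : ℤ) * h := (hlev _).2 q hq hqk
    obtain ⟨i, j, hq'⟩ := ((hlev _).1 q).1 ⟨hq, hq2⟩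
    exact ⟨_, barlowPos_mem _ i j, by rw [hA, hq']⟩
  · rintro ⟨x, ⟨k, i, j, rfl⟩, rfl⟩
    exact (((hlev k).1 _).2 ⟨i, j, hA s k i j⟩).1

end Summit.AtomisticToContinuum.Crystallization.Theorems.PeriodicWindowsSketch

end
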